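import Summits.QuantumFields.YangMills.Theorems.BalabanUVNodesN11K1SupportsOmegaTopGaussianDial

/-!
# DAG node N11 ∕ key K1⁹ — THE Ω-TOP POSITIVITY IS ROBUST UNDER ANY COERCIVE PIN OF `quad`: next to every `θ`, for EVERY residual whose `ζ0` is the indicator
# `𝟙{Y = Ω_{j+1}ᶜ}` and whose form slot `quad_j(Λ′)` is (i) COERCIVE on the A-fibre (`c·Σ_{b∈B_j(Λ′ᶜ∩Ω_{j+1})}‖A_j(b)‖² ≤ quad_j(Λ′)`, `c > 0` — the shape of [I]'s positivity of
# `⟨A, Δ^{(j)}A⟩`), (ii) measurable, (iii) a function of `A_j` and the gauge variables only, H's reference new side `J⁰_P(s′)` is `> 0` at EVERY `V′` at EVERY Ω-top child (zero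
# terms).  So a VALUE row for `quad` ALONE — print's Gaussian included — leaves the v10 𝐒∕𝐓-law clauses of the small-field MAIN TERM met by fiat: on the Ω-top family the cure of
# FLAG №15 is the `ζ0` VALUE row (count-neutral, LOCATED; certificate #5, robustness half)

HEADER — WORK-UNIT METADATA.  Cell `pub-ymgap`, YM-PLAN Track A (HUMAN RULING D-0062), seat `pub-ymgap-dag-n11-d` (g36; N11 [B14], s2), route `BalabanUVNodes`, item K1⁹ =
stmt-QuantumFields-27364 (helper lane, `--kind proof --supports 27364 --as helper`, count-neutral).  [III] = [Balaban1988Convergent], [I] = [Balaban1987RG1].  Over this seat's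
`…N11K1SupportsOmegaTopGaussianDial` (g36 K: §0 bookkeeping, `ζ_empty_eq_one_of_Omega_univ`, `chiAW_empty_eq_chiSmallAW'`), g18 `…N11OmegaTopTStep` (`sect2Slot_eq_of_Omega_univ`), g9
`…N11TkOpMeasurable` (`measurable_tkWeightsOfRecordP_w`), dag-n11-w4 `…N11AFibreDominationOfCoercive` (the Gaussian majorant; its coercivity row shape), 11a, 11c, 12a, RECORD 13 v1.7 `H`.

WHY.  K proved the Ω-top positivity at ONE form slot (the Gaussian of the integrated variables).  The v11 cure of record (director-ym №292∕№293) has two VALUE rows: C2's `quad` (print's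
`⟨A_j, Δ^{(j)}(U_{j+1})A_j⟩` of [I] (1.15)) and K0b's `ζ0`.  This file certifies that the first ALONE does not touch the Ω-top family: whatever coercive, measurable, `(A_j, gauge)`-read
form is pinned, the indicator `ζ0` keeps `J⁰_P(s′) > 0` everywhere there, so H's switch–dial (L §1) still meets the 𝐒∕𝐓-law clause of the main term by fiat (the switch and the dial
live in `ζ0` and in an additive constant of `quad`, which coercivity does not see).  g34 F∕G (`…ZetaValueDial`) made the same point modulo supports; here it is unconditional on the
Ω-top family.

WHAT THIS FILE PROVES (0 `sorry`, 0 `def`, standard axioms).  `integral_afibre_emptyBranch_pos_of_coercive` (the `S_{k+1} = ∅` fibre integral `∫ χ_A(Y,∅)(a)·e^{−½quad_k(Λ′)(a)} da > 0`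
under (i)–(ii): dominated by w4's majorant `Π_b e^{−c‖a_b‖²∕2}`, positive on the (3.16) ball), `integral_afibre_emptyBranch_mul_pos_of_coercive`, ★★★ `sect2Slot_pos_of_Omega_univ_of_coercive`
(any weights with this A-side, unit lower `ζ(∅)`, positive top factor; the lower scalars `w_j(𝕋,∅,∅) = e^{−½quad_j(𝕋)}` are read at the base configuration by (iii)), ★★★
`refNewSide_pos_of_Omega_univ_of_coercive` (H's `J⁰_P(s′) > 0` at every `V′`, every Ω-top child), `newSide_pos_of_Omega_univ_of_coercive`.

HONEST FRAMING.  Count-neutral LOCATED instrument; kernel bookkeeping + folklore measure theory; nothing of Bałaban asserted or refuted; (i)–(iii) are DISPLAYED hypotheses on a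
residual (the shape of [I]'s positivity and locality of `⟨A, Δ^{(j)}A⟩`, NOT asserted for print's operators, which the tree does not construct); `δ_k > 0` displayed (L §0 derives it
from `Admissible` + `γ < 1`); the NON-Ω-top support condition untouched; N11 NOT discharged; K1⁹ NOT closed; no K1⁹ witness; counts unmoved (typed 28∕28 · discharged 8∕27 = 8∕28
incl. NODE O).  One finite four-torus programme at fixed `ε = L^{−K}`; NOT ℝ⁴, NOT OS, NOT a mass gap, NOT Clay.  No `sorry`, `axiom`, `def`, `instance`, `notation`.  Sources (SHAPE
only): [III] (2.18) p.257, (2.21)–(2.23) p.258, (3.16) p.268, (3.21) p.269, (3.23)–(3.25) p.270, (3.4) p.265; [I] (1.15)–(1.16) p.262, (2.11) p.267.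
-/

noncomputable section

open MeasureTheory
open scoped BigOperators Matrix.Norms.L2Operator

namespace Summit.QuantumFields.YangMills.Theorems.BalabanUVNodesN11K1SupportsOmegaTopCoercive

open Literature.MathematicalPhysics.QuantumFieldTheory.Balaban1983to89 T4Continuum
open T4AdjointCovariance (insA JCfg)
open Node00 Node00.Tk B14.Eq218Concrete B14.Sect3Decomp
open B10Eq42TorusConstraint (bondsIn)
open B14.Eq316 (SmallFluct)
open BalabanUVNodesN11TopPairLocalResidual (WtOfRecord₁₃H_ζ_eq_ζ0 WtOfRecord₁₃H_w_univ_empty_empty)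
open BalabanUVNodesN11OmegaTopTStep (sect2Slot_eq_of_Omega_univ)
open BalabanUVNodesN11AFibreDominationOfCoercive (lintegral_gaussMajorant_ne_top exp_neg_half_le_gaussMajorant)
open BalabanUVNodesN11TkOpMeasurable (measurable_tkWeightsOfRecordP_w)
open BalabanUVNodesN11K1SupportsOmegaTopGaussianDial (sect2Operand_zero_update_eq ζ_empty_eq_one_of_Omega_univ chiAW_empty_eq_chiSmallAW')

variable {F : T4Family} {N : ℕ} [NeZero N]

section Positivity

variable {θc : Stage13HParams F N}
variable (hζ : ∀ p n Ω Λ j Y ω, (θc.Zh p n Ω Λ).ζ0 j Y ω = Set.indicator {(Ω (j + 1))ᶜ} (1 : Set (Site (F.P p.K) 0) → ℝ) Y)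
  (hcoer : ∀ (p : B12.RunParams) (n : ℕ) (Ω Λ : ℕ → Set (Site (F.P p.K) 0)) (j : ℕ) (Λ' : Set (Site (F.P p.K) 0)), ∃ c : ℝ, 0 < c ∧
    ∀ ω : MultiCfg (F.P p.K) (SU N) (FluctV N), c * ∑ b ∈ (Set.toFinite (bondsIn j (Λ'ᶜ ∩ Ω (j + 1)))).toFinset, ‖(ω j).2 b‖ ^ 2 ≤ (θc.Zh p n Ω Λ).quad j Λ' ω)
  (hqmeas : ∀ (p : B12.RunParams) (n : ℕ) (Ω Λ : ℕ → Set (Site (F.P p.K) 0)) (j : ℕ) (Λ' : Set (Site (F.P p.K) 0)), Measurable ((θc.Zh p n Ω Λ).quad j Λ'))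
  (hqdep : ∀ (p : B12.RunParams) (n : ℕ) (Ω Λ : ℕ → Set (Site (F.P p.K) 0)) (j : ℕ) (Λ' : Set (Site (F.P p.K) 0)) (ω ω' : MultiCfg (F.P p.K) (SU N) (FluctV N)),
    (∀ i, (ω i).1 = (ω' i).1) → (ω j).2 = (ω' j).2 → (θc.Zh p n Ω Λ).quad j Λ' ω = (θc.Zh p n Ω Λ).quad j Λ' ω')

include hcoer hqmeas in
/-- **THE `S_{k+1} = ∅` A-FIBRE INTEGRAL IS STRICTLY POSITIVE FOR ANY COERCIVE MEASURABLE FORM**: `∫ χ_A(Y, ∅)(a)·e^{−½ quad_k(Λ′)(a)} da > 0` over `B_k(Y) → FluctV N`, `Y = Λ′ᶜ ∩ Ω_{k+1}`,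
at a configuration with vanishing scale-`k` fluctuation variables (`δ_k > 0`): the integrand is measurable, nonnegative, under w4's Gaussian majorant (coercivity) hence integrable, and
`> 0` on the (3.16) ball (`χ_A = 1`, `e^{−½quad} > 0`). [cite: Balaban1988Convergent, (2.21) p.258, (3.16) p.268, (3.21) p.269; Balaban1987RG1, (2.11) p.267 (shape of the row)] -/
theorem integral_afibre_emptyBranch_pos_of_coercive (p : B12.RunParams) {n : ℕ} (s : SeqOfRecord F θc.ν θc.τ9.M (gOfRecord₁₃ F N θc.toStage13Params p) p.K n) (k : ℕ)
    (Λ' : Set (Site (F.P p.K) 0)) (hδ : 0 < deltaOfRecord θc.ν (gOfRecord₁₃ F N θc.toStage13Params p) k θc.A₁)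
    {hdec : DecidableEq (PBond (F.P p.K) k)} (ω : MultiCfg (F.P p.K) (SU N) (FluctV N)) (hω : (ω k).2 = 0) :
    0 < ∫ a : ↥(Set.toFinite (bondsIn k (Λ'ᶜ ∩ s.Ω (k + 1)))).toFinset → FluctV N,
        (WtOfRecord₁₃H F N θc p s).w k Λ' (Λ'ᶜ ∩ s.Ω (k + 1)) ∅ (Function.update ω k (insA (Set.toFinite (bondsIn k (Λ'ᶜ ∩ s.Ω (k + 1)))).toFinset a (ω k)))
      ∂(Measure.pi fun _ => (volume : Measure (FluctV N))) := by
  set sA : Finset (PBond (F.P p.K) k) := (Set.toFinite (bondsIn k (Λ'ᶜ ∩ s.Ω (k + 1)))).toFinset with hsA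
  set upd : (↥sA → FluctV N) → MultiCfg (F.P p.K) (SU N) (FluctV N) := fun a => Function.update ω k (insA sA a (ω k)) with hupd
  obtain ⟨c, hc, hcoer'⟩ := hcoer p n s.Ω s.Λ k Λ'
  have hupdk : ∀ a, (upd a k).2 = Function.updateFinset (ω k).2 sA a := fun a => by
    simp only [hupd, Function.update_self]; rfl
  have hval : ∀ a (b : PBond (F.P p.K) k), (upd a k).2 b = if hb : b ∈ sA then a ⟨b, hb⟩ else 0 := fun a b => by
    rw [hupdk]
    simp only [Function.updateFinset_def]
    split_ifs with hb
    · rfl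
    · rw [hω]; rfl
  -- the coercive bound at the updated configuration is a bound by the sum of squares of the inserted variables
  have hsum : ∀ a, ∑ b ∈ sA, ‖(upd a k).2 b‖ ^ 2 = ∑ b : ↥sA, ‖a b‖ ^ 2 := fun a => by
    rw [← Finset.sum_coe_sort sA]
    refine Finset.sum_congr rfl fun b _ => ?_
    rw [hval, dif_pos b.2]
  have hquad : ∀ a, c * ∑ b : ↥sA, ‖a b‖ ^ 2 ≤ (θc.zhAt p s).quad k Λ' (upd a) := fun a => by
    rw [← hsum a, Stage13HParams.zhAt_quad]
    exact hcoer' (upd a)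
  -- the integrand, unfolded
  have hw : ∀ a, (WtOfRecord₁₃H F N θc p s).w k Λ' (Λ'ᶜ ∩ s.Ω (k + 1)) ∅ (upd a) =
      chiAW F N (FluctV N) θc.ν θc.A₁ p (gOfRecord₁₃ F N θc.toStage13Params p) k (Λ'ᶜ ∩ s.Ω (k + 1)) ∅ (upd a) *
        Real.exp (-(1 / 2 : ℝ) * (θc.zhAt p s).quad k Λ' (upd a)) := fun a => rfl
  have hmu : Measurable upd := (measurable_update ω).comp (measurable_const.prodMk measurable_updateFinset)
  have hmeas : Measurable fun a => (WtOfRecord₁₃H F N θc p s).w k Λ' (Λ'ᶜ ∩ s.Ω (k + 1)) ∅ (upd a) :=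
    (measurable_tkWeightsOfRecordP_w F N (FluctV N) θc.ν θc.A₁ p (gOfRecord₁₃ F N θc.toStage13Params p) (θc.zhAt p s) k Λ' _ ∅ (hqmeas p n s.Ω s.Λ k Λ')).comp hmu
  have hnn : ∀ a, 0 ≤ (WtOfRecord₁₃H F N θc p s).w k Λ' (Λ'ᶜ ∩ s.Ω (k + 1)) ∅ (upd a) := fun a => by
    rw [hw]; exact mul_nonneg (chiAW_nonneg _ _ _ _) (Real.exp_nonneg _)
  have hle : ∀ a, (WtOfRecord₁₃H F N θc p s).w k Λ' (Λ'ᶜ ∩ s.Ω (k + 1)) ∅ (upd a) ≤ ∏ b : ↥sA, Real.exp (-(c * ‖a b‖ ^ 2) / 2) := fun a => by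
    rw [hw]
    calc chiAW F N (FluctV N) θc.ν θc.A₁ p (gOfRecord₁₃ F N θc.toStage13Params p) k (Λ'ᶜ ∩ s.Ω (k + 1)) ∅ (upd a) *
          Real.exp (-(1 / 2 : ℝ) * (θc.zhAt p s).quad k Λ' (upd a))
        ≤ Real.exp (-(1 / 2 : ℝ) * (θc.zhAt p s).quad k Λ' (upd a)) := mul_le_of_le_one_left (Real.exp_nonneg _) (chiAW_le_one _ _ _ _)
      _ ≤ ∏ b : ↥sA, Real.exp (-(c * ‖a b‖ ^ 2) / 2) := exp_neg_half_le_gaussMajorant Finset.univ a (hquad a)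
  have hint_gauss : Integrable (fun a : ↥sA → FluctV N => ∏ b : ↥sA, Real.exp (-(c * ‖a b‖ ^ 2) / 2)) (Measure.pi fun _ => (volume : Measure (FluctV N))) := by
    have hm : Measurable fun a : ↥sA → FluctV N => ∏ b : ↥sA, Real.exp (-(c * ‖a b‖ ^ 2) / 2) :=
      Finset.measurable_prod _ fun b _ => Real.measurable_exp.comp (((measurable_const.mul ((measurable_pi_apply b).norm.pow_const 2)).neg).div_const 2)
    refine ⟨hm.aestronglyMeasurable, (hasFiniteIntegral_iff_ofReal (Filter.Eventually.of_forall fun a => ?_)).2 ?_⟩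
    · exact Finset.prod_nonneg fun b _ => (Real.exp_pos _).le
    · have e : (fun a : ↥sA → FluctV N => ENNReal.ofReal (∏ b : ↥sA, Real.exp (-(c * ‖a b‖ ^ 2) / 2))) =
          fun a => ∏ b : ↥sA, ENNReal.ofReal (Real.exp (-(c * ‖a b‖ ^ 2) / 2)) :=
        funext fun a => ENNReal.ofReal_prod_of_nonneg fun b _ => (Real.exp_pos _).le
      rw [e]
      exact (lintegral_gaussMajorant_ne_top (ι := ↥sA) (κ := Fin (N ^ 2 - 1)) hc).lt_top
  have hint : Integrable (fun a => (WtOfRecord₁₃H F N θc p s).w k Λ' (Λ'ᶜ ∩ s.Ω (k + 1)) ∅ (upd a)) (Measure.pi fun _ => (volume : Measure (FluctV N))) :=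
    hint_gauss.mono' hmeas.aestronglyMeasurable (Filter.Eventually.of_forall fun a => by
      rw [Real.norm_eq_abs, abs_of_nonneg (hnn a)]; exact hle a)
  have hbox : Metric.ball (0 : ↥sA → FluctV N) (deltaOfRecord θc.ν (gOfRecord₁₃ F N θc.toStage13Params p) k θc.A₁) ⊆
      Function.support fun a => (WtOfRecord₁₃H F N θc p s).w k Λ' (Λ'ᶜ ∩ s.Ω (k + 1)) ∅ (upd a) := by
    intro a ha
    rw [mem_ball_zero_iff, pi_norm_lt_iff hδ] at ha
    have hsmall : ∀ b : PBond (F.P p.K) k, ‖(upd a k).2 b‖ < deltaOfRecord θc.ν (gOfRecord₁₃ F N θc.toStage13Params p) k θc.A₁ := fun b => by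
      rw [hval]
      split_ifs with hb
      · exact ha ⟨b, hb⟩
      · rwa [norm_zero]
    have hχ : chiAW F N (FluctV N) θc.ν θc.A₁ p (gOfRecord₁₃ F N θc.toStage13Params p) k (Λ'ᶜ ∩ s.Ω (k + 1)) ∅ (upd a) = 1 := by
      classical
      rw [chiAW_empty_eq_chiSmallAW', chiSmallAW_eq_ite]
      exact if_pos fun c' _ b _ => hsmall b
    rw [Function.mem_support, hw, hχ, one_mul]
    exact (Real.exp_pos _).ne'
  have hvol : 0 < (Measure.pi fun _ : ↥sA => (volume : Measure (FluctV N))) (Function.support fun a => (WtOfRecord₁₃H F N θc p s).w k Λ' (Λ'ᶜ ∩ s.Ω (k + 1)) ∅ (upd a)) :=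
    lt_of_lt_of_le (Metric.isOpen_ball.measure_pos _ ⟨0, Metric.mem_ball_self hδ⟩) (measure_mono hbox)
  exact (integral_pos_iff_support_of_nonneg hnn hint).2 hvol

include hcoer hqmeas in
/-- **… times any factor constant along the fibre.** [cite: Balaban1988Convergent, (2.21) p.258, (3.23) p.270 (bookkeeping)] -/
theorem integral_afibre_emptyBranch_mul_pos_of_coercive (p : B12.RunParams) {n : ℕ} (s : SeqOfRecord F θc.ν θc.τ9.M (gOfRecord₁₃ F N θc.toStage13Params p) p.K n) (k : ℕ)
    (Λ' : Set (Site (F.P p.K) 0)) (hδ : 0 < deltaOfRecord θc.ν (gOfRecord₁₃ F N θc.toStage13Params p) k θc.A₁) {hdec : DecidableEq (PBond (F.P p.K) k)}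
    (W : TkWeights F N (FluctV N) p.K) (hw : ∀ j Λ₁ Y S₁, W.w j Λ₁ Y S₁ = (WtOfRecord₁₃H F N θc p s).w j Λ₁ Y S₁) (S₁ : Set (Site (F.P p.K) 0)) (hS₁ : S₁ = ∅)
    (ω : MultiCfg (F.P p.K) (SU N) (FluctV N)) (hω : (ω k).2 = 0) (G : MultiCfg (F.P p.K) (SU N) (FluctV N) → ℝ) (c : ℝ) (hc : 0 < c)
    (hG : ∀ a : ↥(Set.toFinite (bondsIn k (Λ'ᶜ ∩ s.Ω (k + 1)))).toFinset → FluctV N,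
      G (Function.update ω k (insA (Set.toFinite (bondsIn k (Λ'ᶜ ∩ s.Ω (k + 1)))).toFinset a (ω k))) = c) :
    0 < ∫ a : ↥(Set.toFinite (bondsIn k (Λ'ᶜ ∩ s.Ω (k + 1)))).toFinset → FluctV N,
        W.w k Λ' (Λ'ᶜ ∩ s.Ω (k + 1)) S₁ (Function.update ω k (insA (Set.toFinite (bondsIn k (Λ'ᶜ ∩ s.Ω (k + 1)))).toFinset a (ω k))) *
          G (Function.update ω k (insA (Set.toFinite (bondsIn k (Λ'ᶜ ∩ s.Ω (k + 1)))).toFinset a (ω k)))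
      ∂(Measure.pi fun _ => (volume : Measure (FluctV N))) := by
  subst hS₁
  simp_rw [hG, hw]
  rw [integral_mul_const]
  exact mul_pos (integral_afibre_emptyBranch_pos_of_coercive hcoer hqmeas p s k Λ' hδ (hdec := hdec) ω hω) hc

include hcoer hqmeas hqdep in
/-- ★★★ **THE Ω-TOP POSITIVITY FOR ANY COERCIVE, MEASURABLE, `(A_j, gauge)`-READ FORM SLOT** (indicator `ζ0` below the top by the weights' hypotheses; ZERO terms; any setting,
residual, constant, background map): `0 < sect2Slot(W, s′, 0, E, U)(V′)` at every `V′` whenever `Ω_{k+1}(s′) = 𝕋` — g18's closed form ≥ its `Y = ∅` summand `= ζ_k · c₀ · ∫ (fibre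
integrand) > 0`, `c₀ = (Π_{j<k} e^{−½quad_j(𝕋)(base V′)}) · e^{A_{k+1}(s′;0,E)(U(base V′))}` (the lower scalars and the operand are constant along the scale-`k` fibre by (iii) and K §0).
[cite: Balaban1988Convergent, (2.18) p.257, (2.21)–(2.23) p.258, (3.16) p.268, (3.21) p.269, (3.23)–(3.25) p.270; Balaban1987RG1, (2.11) p.267 (shape)] -/
theorem sect2Slot_pos_of_Omega_univ_of_coercive (p : B12.RunParams) {k : ℕ} (s' : SeqOfRecord F θc.ν θc.τ9.M (gOfRecord₁₃ F N θc.toStage13Params p) p.K (k + 1))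
    (hΩ : s'.Ω (k + 1) = Set.univ) (hδ : 0 < deltaOfRecord θc.ν (gOfRecord₁₃ F N θc.toStage13Params p) k θc.A₁)
    (W : TkWeights F N (FluctV N) p.K) (hζk : ∀ ω, 0 < W.ζ k (s'.Ω (k + 1))ᶜ ω) (hζlt : ∀ j, j < k → ∀ ω, W.ζ j ∅ ω = 1)
    (hw : ∀ j Λ₁ Y S₁, W.w j Λ₁ Y S₁ = (WtOfRecord₁₃H F N θc p s').w j Λ₁ Y S₁)
    {𝔸 : Type*} [NormedRing 𝔸] [NormedAlgebra ℂ 𝔸] [CompleteSpace 𝔸] (Sg : Sect2.Setting 𝔸 (SU N)) (Rz : Sect2.Residual (F.P p.K) 𝔸) (E' : ℝ) (U : BgMap F N p.K)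
    (V' : GaugeField (F.P p.K) (k + 1) (SU N)) :
    0 < sect2Slot F N (FluctV N) p.K Sg Rz W s' (Sect2.TermValues.zero : Sect2.TermValues (F.P p.K) 𝔸 (FluctV N) θc.τ9.M) E' U V' := by
  have hdec : DecidableEq (PBond (F.P p.K) k) := fun a b => Classical.propDecidable (a = b)
  rw [sect2Slot_eq_of_Omega_univ F N θc.ν θc.τ9 p (gOfRecord₁₃ F N θc.toStage13Params p) k Sg Rz W s' hΩ _ E' U V' (hdec := hdec)]
  have hw0 : ∀ j Λ₁ Y S₁ ω, 0 ≤ W.w j Λ₁ Y S₁ ω := fun j Λ₁ Y S₁ ω => by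
    rw [hw]; exact mul_nonneg (chiAW_nonneg _ _ _ _) (Real.exp_nonneg _)
  have hG0 : ∀ (Y : Set (Site (F.P p.K) 0)) (ω : MultiCfg (F.P p.K) (SU N) (FluctV N)),
      0 ≤ (∏ j ∈ Finset.range k, W.ζ j ∅ ω * W.w j Set.univ ∅ ∅ ω) *
        sect2Operand F N (FluctV N) p.K Sg Rz s' (Sect2.TermValues.zero : Sect2.TermValues (F.P p.K) 𝔸 (FluctV N) θc.τ9.M) E' U
          (Function.update (fun _ => ∅) (k + 1) Y, fun j => (ω j).2) (fun j => (ω j).1) := fun Y ω =>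
    mul_nonneg (Finset.prod_nonneg fun j hj => by rw [hζlt j (Finset.mem_range.1 hj)]; exact mul_nonneg zero_le_one (hw0 _ _ _ _ _))
      (sect2Operand_pos _ _ _ _ _ _ _ _ _).le
  have hterm : ∀ Y : Set (Site (F.P p.K) 0), 0 ≤ W.ζ k (s'.Ω (k + 1))ᶜ (baseCfg (k + 1) V') *
      aOp k (genDataOfRecord F N (FluctV N) θc.ν θc.τ9.M (gOfRecord₁₃ F N θc.toStage13Params p) p.K W s' (Function.update (fun _ => ∅) (k + 1) Y) k).sA
        (genDataOfRecord F N (FluctV N) θc.ν θc.τ9.M (gOfRecord₁₃ F N θc.toStage13Params p) p.K W s' (Function.update (fun _ => ∅) (k + 1) Y) k).w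
        (fun ω => (∏ j ∈ Finset.range k, W.ζ j ∅ ω * W.w j Set.univ ∅ ∅ ω) *
          sect2Operand F N (FluctV N) p.K Sg Rz s' (Sect2.TermValues.zero : Sect2.TermValues (F.P p.K) 𝔸 (FluctV N) θc.τ9.M) E' U
            (Function.update (fun _ => ∅) (k + 1) Y, fun j => (ω j).2) (fun j => (ω j).1)) (baseCfg (k + 1) V') := fun Y =>
    mul_nonneg (hζk _).le (aOp_nonneg k _
      (w := W.w k (s'.Λ (k + 1)) ((s'.Λ (k + 1))ᶜ ∩ s'.Ω (k + 1)) (Function.update (fun _ => (∅ : Set (Site (F.P p.K) 0))) (k + 1) Y (k + 1)))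
      (hw0 _ _ _ _) (hG0 Y) _)
  have hmem : (∅ : Set (Site (F.P p.K) 0)) ∈ (Set.toFinite {Y : Set (Site (F.P p.K) 0) |
      Y ∈ SClassOfRecord F θc.ν (gOfRecord₁₃ F N θc.toStage13Params p) p.K (k + 1) ∧ Y ⊆ s'.Ω (k + 1) ∩ (s'.Λ (k + 1))ᶜ}).toFinset :=
    (Set.Finite.mem_toFinset _).2 ⟨empty_mem_SClassOfRecord F θc.ν _ p.K (k + 1), Set.empty_subset _⟩
  refine lt_of_lt_of_le ?_ (Finset.single_le_sum
    (s := (Set.toFinite {Y : Set (Site (F.P p.K) 0) |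
      Y ∈ SClassOfRecord F θc.ν (gOfRecord₁₃ F N θc.toStage13Params p) p.K (k + 1) ∧ Y ⊆ s'.Ω (k + 1) ∩ (s'.Λ (k + 1))ᶜ}).toFinset)
    (f := fun Y : Set (Site (F.P p.K) 0) => W.ζ k (s'.Ω (k + 1))ᶜ (baseCfg (k + 1) V') *
      aOp k (genDataOfRecord F N (FluctV N) θc.ν θc.τ9.M (gOfRecord₁₃ F N θc.toStage13Params p) p.K W s' (Function.update (fun _ => ∅) (k + 1) Y) k).sA
        (genDataOfRecord F N (FluctV N) θc.ν θc.τ9.M (gOfRecord₁₃ F N θc.toStage13Params p) p.K W s' (Function.update (fun _ => ∅) (k + 1) Y) k).w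
        (fun ω => (∏ j ∈ Finset.range k, W.ζ j ∅ ω * W.w j Set.univ ∅ ∅ ω) *
          sect2Operand F N (FluctV N) p.K Sg Rz s' (Sect2.TermValues.zero : Sect2.TermValues (F.P p.K) 𝔸 (FluctV N) θc.τ9.M) E' U
            (Function.update (fun _ => ∅) (k + 1) Y, fun j => (ω j).2) (fun j => (ω j).1)) (baseCfg (k + 1) V'))
    (fun Y _ => hterm Y) hmem)
  refine mul_pos (hζk _) ?_
  rw [aOp_apply]
  -- the fibre-constant factor: lower `ζ = 1`, lower `w_j(𝕋,∅,∅) = e^{−½quad_j(𝕋)}` read at the base configuration (iii), operand fluctuation-blind (K §0)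
  have hc₀ : 0 < (∏ j ∈ Finset.range k, Real.exp (-(1 / 2 : ℝ) * (θc.Zh p (k + 1) s'.Ω s'.Λ).quad j Set.univ (baseCfg (V := FluctV N) (k + 1) V'))) *
      sect2Operand F N (FluctV N) p.K Sg Rz s' (Sect2.TermValues.zero : Sect2.TermValues (F.P p.K) 𝔸 (FluctV N) θc.τ9.M) E' U
        (Function.update (fun _ => ∅) (k + 1) ∅, fun j => ((baseCfg (V := FluctV N) (k + 1) V') j).2) (fun j => ((baseCfg (V := FluctV N) (k + 1) V') j).1) :=
    mul_pos (Finset.prod_pos fun j _ => Real.exp_pos _) (sect2Operand_pos _ _ _ _ _ _ _ _ _)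
  refine integral_afibre_emptyBranch_mul_pos_of_coercive hcoer hqmeas p s' k (s'.Λ (k + 1)) hδ (hdec := hdec) W hw _
    (Function.update_self (k + 1) (∅ : Set (Site (F.P p.K) 0)) (fun _ => (∅ : Set (Site (F.P p.K) 0)))) (baseCfg (k + 1) V') (baseCfg_snd _ _ _)
    (fun ω => (∏ j ∈ Finset.range k, W.ζ j ∅ ω * W.w j Set.univ ∅ ∅ ω) *
      sect2Operand F N (FluctV N) p.K Sg Rz s' (Sect2.TermValues.zero : Sect2.TermValues (F.P p.K) 𝔸 (FluctV N) θc.τ9.M) E' U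
        (Function.update (fun _ => ∅) (k + 1) ∅, fun j => (ω j).2) (fun j => (ω j).1)) _ hc₀ fun a => ?_
  beta_reduce
  refine congrArg₂ (· * ·) (Finset.prod_congr rfl fun j hj => ?_) (sect2Operand_zero_update_eq p.K Sg Rz s' E' U _ _ k _ rfl)
  rw [hζlt j (Finset.mem_range.1 hj), one_mul, hw, WtOfRecord₁₃H_w_univ_empty_empty]
  refine congrArg Real.exp (congrArg _ (hqdep p (k + 1) s'.Ω s'.Λ j Set.univ _ _ (fun i => ?_) ?_))
  · by_cases hi : i = k
    · subst hi; rw [Function.update_self]; rfl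
    · rw [Function.update_of_ne hi]
  · rw [Function.update_of_ne (Nat.ne_of_lt (Finset.mem_range.1 hj))]

include hζ hcoer hqmeas hqdep in
/-- ★★★ **… IN PARTICULAR H's REFERENCE NEW SIDE `J⁰_P(s′)` (top factor `:= 1`) IS `> 0` AT EVERY `V′` AT EVERY Ω-TOP CHILD for every such residual** — a `quad` VALUE row ALONE (any coercive
measurable `(A_j, gauge)`-read form, print's Gaussian included) leaves the support condition of certs #2∕#4 TRUE OUTRIGHT on the Ω-top family, hence L §1's switch–dial meets the 𝐒∕𝐓-law
clause of the small-field main term by fiat. [cite: Balaban1988Convergent, (2.18) p.257, (2.21)–(2.23) p.258, (3.23)–(3.25) p.270; Balaban1987RG1, (1.15)–(1.16) p.262 (shape)] -/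
theorem refNewSide_pos_of_Omega_univ_of_coercive (p : B12.RunParams) {k : ℕ} (s' : SeqOfRecord F θc.ν θc.τ9.M (gOfRecord₁₃ F N θc.toStage13Params p) p.K (k + 1))
    (hΩ : s'.Ω (k + 1) = Set.univ) (hδ : 0 < deltaOfRecord θc.ν (gOfRecord₁₃ F N θc.toStage13Params p) k θc.A₁)
    {𝔸 : Type*} [NormedRing 𝔸] [NormedAlgebra ℂ 𝔸] [CompleteSpace 𝔸] (Sg : Sect2.Setting 𝔸 (SU N)) (Rz : Sect2.Residual (F.P p.K) 𝔸) (E' : ℝ) (U : BgMap F N p.K)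
    (V' : GaugeField (F.P p.K) (k + 1) (SU N)) :
    0 < sect2Slot F N (FluctV N) p.K Sg Rz { WtOfRecord₁₃H F N θc p s' with ζ := fun j Y ω => if j = k then 1 else (WtOfRecord₁₃H F N θc p s').ζ j Y ω } s'
      (Sect2.TermValues.zero : Sect2.TermValues (F.P p.K) 𝔸 (FluctV N) θc.τ9.M) E' U V' :=
  sect2Slot_pos_of_Omega_univ_of_coercive hcoer hqmeas hqdep p s' hΩ hδ
    (W := { WtOfRecord₁₃H F N θc p s' with ζ := fun j Y ω => if j = k then 1 else (WtOfRecord₁₃H F N θc p s').ζ j Y ω })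
    (fun ω => by show 0 < (if k = k then (1 : ℝ) else _); rw [if_pos rfl]; exact one_pos)
    (fun j hj ω => by
      show (if j = k then (1 : ℝ) else (WtOfRecord₁₃H F N θc p s').ζ j ∅ ω) = 1
      rw [if_neg (Nat.ne_of_lt hj)]
      exact ζ_empty_eq_one_of_Omega_univ hζ p s' hΩ hj.le ω)
    (fun _ _ _ _ => rfl) Sg Rz E' U V'

include hζ hcoer hqmeas hqdep in
/-- ★★ **… AND THE RESIDUAL's OWN §2-FORM SLOT** (top factor `ζ_k(∅) = 1` at an Ω-top child). [cite: Balaban1988Convergent, (2.18) p.257, (2.21)–(2.23) p.258, (3.23)–(3.25) p.270] -/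
theorem newSide_pos_of_Omega_univ_of_coercive (p : B12.RunParams) {k : ℕ} (s' : SeqOfRecord F θc.ν θc.τ9.M (gOfRecord₁₃ F N θc.toStage13Params p) p.K (k + 1))
    (hΩ : s'.Ω (k + 1) = Set.univ) (hδ : 0 < deltaOfRecord θc.ν (gOfRecord₁₃ F N θc.toStage13Params p) k θc.A₁)
    {𝔸 : Type*} [NormedRing 𝔸] [NormedAlgebra ℂ 𝔸] [CompleteSpace 𝔸] (Sg : Sect2.Setting 𝔸 (SU N)) (Rz : Sect2.Residual (F.P p.K) 𝔸) (E' : ℝ) (U : BgMap F N p.K)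
    (V' : GaugeField (F.P p.K) (k + 1) (SU N)) :
    0 < sect2Slot F N (FluctV N) p.K Sg Rz (WtOfRecord₁₃H F N θc p s') s' (Sect2.TermValues.zero : Sect2.TermValues (F.P p.K) 𝔸 (FluctV N) θc.τ9.M) E' U V' :=
  sect2Slot_pos_of_Omega_univ_of_coercive hcoer hqmeas hqdep p s' hΩ hδ _
    (fun ω => by rw [hΩ, Set.compl_univ, ζ_empty_eq_one_of_Omega_univ hζ p s' hΩ le_rfl ω]; exact one_pos)
    (fun j hj ω => ζ_empty_eq_one_of_Omega_univ hζ p s' hΩ hj.le ω) (fun _ _ _ _ => rfl) Sg Rz E' U V'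

end Positivity

end Summit.QuantumFields.YangMills.Theorems.BalabanUVNodesN11K1SupportsOmegaTopCoercive

end
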